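import Literature.AlgebraicTopology.Homotopy.SimplexHat
import HarnessLib

/-!
# The stellar subdivision of the corner simplex from its centre

Topic `Literature/AlgebraicTopology/Homotopy`, continuing `SimplexHat.lean`. The corner simplex
`cornerSimplex k ⊆ ℝᵏ` (barycentric coordinates `baryCoords y : Fin (k + 1) → ℝ`) is the union of
the `k + 1` **stellar cells** `stellarCell j = {y | baryCoords y j is minimal}`, the cones from the
centre over the facets. This file records the elementary geometry used by the stellar homotopy
addition theorem (`StellarHAT.lean`):

* `stellarCell j`: closed, convex; the cells cover the corner simplex; their interiors are pairwise
  disjoint (`disjoint_interior_stellarCell`); a point of a cell with all defining inequalities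
  strict and all barycentric coordinates positive is interior (`mem_interior_stellarCell`);
* `stellarFun j ν = ((k+1) νⱼ, (ν_l - νⱼ)_{l ≠ j})` and `stellarPt j s h : stdSimplex`: the affine
  identification of the region `{νⱼ minimal}` of `Δᵏ` with `Δᵏ` (vertex `0` ↦ centre), and
  `exists_stellarPt_eq_zero`: it sends the relative boundary of the region to `∂Δᵏ`;
* `stellarCenter j`: an explicit interior point of `stellarCell j` (the centre pushed away from the
  vertex `j` by `ε j = (j + 1) / (4 (k + 1)²)`), with its coordinates.

Everything is proved; `[folklore]`.

## References

* A. Hatcher, *Algebraic Topology*, CUP (2002), §2.1 (barycentric subdivision, pp. 119–120).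
  [HatcherAT2002]
-/

noncomputable section

open Set Metric Topology
open scoped Topology.Homotopy

universe u

namespace Literature.AlgebraicTopology.Homotopy

variable {k : ℕ}

/-! ### Stellar cells -/

/-- The **stellar cell** of the corner simplex where the `j`-th barycentric coordinate is minimal.
[folklore] -/
def stellarCell (j : Fin (k + 1)) : Set (Fin k → ℝ) :=
  {y | y ∈ cornerSimplex k ∧ ∀ l, baryCoords y j ≤ baryCoords y l}

/-- Barycentric coordinates are affine: `baryCoords (a • y + b • z) = a • baryCoords y + b • baryCoords z`
for `a + b = 1`. [folklore] -/
theorem baryCoords_combo (y z : Fin k → ℝ) {a b : ℝ} (hab : a + b = 1) :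
    baryCoords (a • y + b • z) = a • baryCoords y + b • baryCoords z := by
  funext i
  refine Fin.cases ?_ (fun m => ?_) i
  · rw [Pi.add_apply, Pi.smul_apply, Pi.smul_apply, baryCoords_zero, baryCoords_zero, baryCoords_zero]
    have h1 : ∑ i, (a • y + b • z) i = a * ∑ i, y i + b * ∑ i, z i := by
      simp only [Pi.add_apply, Pi.smul_apply, smul_eq_mul, Finset.sum_add_distrib, Finset.mul_sum]
    rw [h1, smul_eq_mul, smul_eq_mul]
    linear_combination -hab
  · simp

/-- Each barycentric coordinate is a continuous function. [folklore] -/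
theorem continuous_baryCoords_apply (i : Fin (k + 1)) : Continuous fun y : Fin k → ℝ => baryCoords y i :=
  (continuous_apply i).comp continuous_baryCoords

/-- Stellar cells are closed. [folklore] -/
theorem isClosed_stellarCell (j : Fin (k + 1)) : IsClosed (stellarCell (k := k) j) := by
  have h : stellarCell (k := k) j =
      cornerSimplex k ∩ ⋂ l, {y : Fin k → ℝ | baryCoords y j ≤ baryCoords y l} := by
    ext y; simp [stellarCell]
  rw [h]
  exact isClosed_cornerSimplex.inter (isClosed_iInter fun l =>
    isClosed_le (continuous_baryCoords_apply j) (continuous_baryCoords_apply l))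

/-- Stellar cells are convex. [folklore] -/
theorem convex_stellarCell (j : Fin (k + 1)) : Convex ℝ (stellarCell (k := k) j) := by
  intro y hy z hz a b ha hb hab
  refine ⟨convex_cornerSimplex hy.1 hz.1 ha hb hab, fun l => ?_⟩
  rw [baryCoords_combo y z hab]
  simp only [Pi.add_apply, Pi.smul_apply, smul_eq_mul]
  nlinarith [hy.2 l, hz.2 l]

/-- **The stellar cells cover the corner simplex** (a minimal barycentric coordinate exists).
[folklore] -/
theorem exists_mem_stellarCell {y : Fin k → ℝ} (hy : y ∈ cornerSimplex k) : ∃ j, y ∈ stellarCell j := by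
  obtain ⟨j, -, hj⟩ := Finset.exists_min_image Finset.univ (baryCoords y) Finset.univ_nonempty
  exact ⟨j, hy, fun l => hj l (Finset.mem_univ l)⟩

/-- A point of a stellar cell with all defining inequalities strict and all barycentric
coordinates positive is an interior point. [folklore] -/
theorem mem_interior_stellarCell {j : Fin (k + 1)} {y : Fin k → ℝ}
    (hstrict : ∀ l, l ≠ j → baryCoords y j < baryCoords y l) (hpos : ∀ i, 0 < baryCoords y i) :
    y ∈ interior (stellarCell j) := by
  -- the open set of points with the same strict inequalities lies in the cell
  set O : Set (Fin k → ℝ) :=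
    {z | (∀ i, 0 < baryCoords z i) ∧ ∀ l, l ≠ j → baryCoords z j < baryCoords z l} with hO
  have hopen : IsOpen O := by
    have h1 : O = (⋂ i, {z : Fin k → ℝ | 0 < baryCoords z i}) ∩
        ⋂ l ∈ {l : Fin (k + 1) | l ≠ j}, {z : Fin k → ℝ | baryCoords z j < baryCoords z l} := by
      ext z; simp [hO]
    rw [h1]
    exact (isOpen_iInter_of_finite fun i => isOpen_lt continuous_const (continuous_baryCoords_apply i)).inter
      (Set.Finite.isOpen_biInter (Set.toFinite _) fun l _ =>
        isOpen_lt (continuous_baryCoords_apply j) (continuous_baryCoords_apply l))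
  refine mem_interior.2 ⟨O, fun z hz => ?_, hopen, ⟨hpos, hstrict⟩⟩
  obtain ⟨hzpos, hzlt⟩ := hz
  refine ⟨⟨fun i => ?_, ?_⟩, fun l => ?_⟩
  · have := hzpos i.succ; rw [baryCoords_succ] at this; exact this.le
  · have := hzpos 0; rw [baryCoords_zero] at this; linarith
  · rcases eq_or_ne l j with rfl | hl
    · exact le_rfl
    · exact (hzlt l hl).le

/-- A point of a stellar cell off its interior has two equal minimal barycentric coordinates or a
vanishing barycentric coordinate. [folklore] -/
theorem eq_or_zero_of_not_mem_interior {j : Fin (k + 1)} {y : Fin k → ℝ} (hy : y ∈ stellarCell j)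
    (hy' : y ∉ interior (stellarCell j)) :
    (∃ l, l ≠ j ∧ baryCoords y j = baryCoords y l) ∨ ∃ i, baryCoords y i = 0 := by
  by_contra hcon
  simp only [not_or, not_exists, not_and] at hcon
  apply hy'
  refine mem_interior_stellarCell (fun l hl => lt_of_le_of_ne (hy.2 l) (hcon.1 l hl)) fun i => ?_
  exact lt_of_le_of_ne ((baryCoords_mem hy.1).1 i) (Ne.symm (hcon.2 i))

/-- **The interiors of distinct stellar cells are disjoint.** [folklore] -/
theorem disjoint_interior_stellarCell : Pairwise fun i j : Fin (k + 1) =>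
    Disjoint (interior (stellarCell (k := k) i)) (interior (stellarCell j)) := by
  intro i j hij
  rw [Set.disjoint_left]
  intro y hyi hyj
  -- a direction `d` along which `baryCoords · i - baryCoords · j` strictly increases
  obtain ⟨d, hd⟩ : ∃ d : Fin k → ℝ, ∀ (s : ℝ) (z : Fin k → ℝ),
      (baryCoords (z + s • d) i - baryCoords (z + s • d) j) =
        (baryCoords z i - baryCoords z j) + s := by
    -- `baryCoords (z + s • d) = baryCoords z + s • L d` with `L d = (-∑ d, d)`
    have hlin : ∀ (d : Fin k → ℝ) (s : ℝ) (z : Fin k → ℝ) (l : Fin (k + 1)),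
        baryCoords (z + s • d) l = baryCoords z l + s * (Fin.cons (-(∑ m, d m)) d : Fin (k + 1) → ℝ) l := by
      intro d s z l
      refine Fin.cases ?_ (fun m => ?_) l
      · simp only [baryCoords_zero, Pi.add_apply, Pi.smul_apply, smul_eq_mul, Finset.sum_add_distrib,
          ← Finset.mul_sum, Fin.cons_zero]
        ring
      · simp
    -- choose `d` with `(L d) i - (L d) j = 1`
    rcases Fin.eq_zero_or_eq_succ i with rfl | ⟨i', rfl⟩
    · -- `i = 0`, `j = succ j'`
      obtain ⟨j', rfl⟩ := Fin.exists_succ_eq.2 hij.symm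
      refine ⟨Pi.single j' (-(2⁻¹ : ℝ)), fun s z => ?_⟩
      rw [hlin, hlin]
      simp [Fin.cons_zero, Fin.cons_succ, Finset.sum_pi_single']
      ring
    · by_cases hj : j = 0
      · subst hj
        refine ⟨Pi.single i' (2⁻¹ : ℝ), fun s z => ?_⟩
        rw [hlin, hlin]
        simp [Fin.cons_zero, Fin.cons_succ, Finset.sum_pi_single']
        ring
      · obtain ⟨j', rfl⟩ := Fin.exists_succ_eq.2 hj
        have hij' : i' ≠ j' := fun h => hij (by rw [h])
        refine ⟨Pi.single i' 1, fun s z => ?_⟩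
        rw [hlin, hlin]
        simp [Fin.cons_succ, hij'.symm]
        ring
  -- move a little along `d`: stay in both interiors, contradiction with the defining inequalities
  have hcont : Continuous fun s : ℝ => y + s • d := by fun_prop
  have h1 : ∀ᶠ s in 𝓝 (0 : ℝ), y + s • d ∈ interior (stellarCell i) :=
    hcont.continuousAt.eventually (isOpen_interior.mem_nhds (by simpa using hyi))
  have h2 : ∀ᶠ s in 𝓝 (0 : ℝ), y + s • d ∈ interior (stellarCell j) :=
    hcont.continuousAt.eventually (isOpen_interior.mem_nhds (by simpa using hyj))
  have h3 : ∀ᶠ s in 𝓝[>] (0 : ℝ), (0 : ℝ) < s := eventually_mem_nhdsWithin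
  obtain ⟨s, ⟨hsi, hsj⟩, hs0⟩ :=
    (((h1.and h2).filter_mono nhdsWithin_le_nhds).and h3).exists
  have hmemi := (interior_subset hsi).2 j   -- `bary i ≤ bary j` at `y + s d`
  have hmemj := (interior_subset hyj).2 i   -- `bary j ≤ bary i` at `y`
  have hmemi0 := (interior_subset hyi).2 j  -- `bary i ≤ bary j` at `y`
  have := hd s y
  linarith

/-! ### The stellar parametrisation of a region -/

/-- The **stellar map** of the region `{νⱼ minimal}`: `ν ↦ ((k+1) νⱼ, (ν_l - νⱼ)_{l ≠ j})`, the
affine identification of the region with the standard simplex sending the centre to the vertex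
`0` and the vertices `l ≠ j` to the other vertices in order. [folklore] -/
def stellarFun (j : Fin (k + 1)) (ν : Fin (k + 1) → ℝ) : Fin (k + 1) → ℝ :=
  Fin.cons (((k : ℝ) + 1) * ν j) fun m => ν (j.succAbove m) - ν j

/-- The zeroth coordinate of the stellar map. [folklore] -/
@[simp] theorem stellarFun_zero (j : Fin (k + 1)) (ν : Fin (k + 1) → ℝ) :
    stellarFun j ν 0 = ((k : ℝ) + 1) * ν j := by simp [stellarFun]

/-- The other coordinates of the stellar map. [folklore] -/
@[simp] theorem stellarFun_succ (j : Fin (k + 1)) (ν : Fin (k + 1) → ℝ) (m : Fin k) :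
    stellarFun j ν m.succ = ν (j.succAbove m) - ν j := by simp [stellarFun]

/-- The stellar map preserves the coordinate sum `1`. [folklore] -/
theorem sum_stellarFun (j : Fin (k + 1)) {ν : Fin (k + 1) → ℝ} (hν : ∑ i, ν i = 1) :
    ∑ i, stellarFun j ν i = 1 := by
  rw [Fin.sum_univ_succ, stellarFun_zero]
  simp only [stellarFun_succ, Finset.sum_sub_distrib, Finset.sum_const, Finset.card_univ,
    Fintype.card_fin, nsmul_eq_mul]
  rw [Fin.sum_univ_succAbove ν j] at hν
  linarith

/-- The stellar map is continuous. [folklore] -/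
@[fun_prop]
theorem continuous_stellarFun (j : Fin (k + 1)) : Continuous (stellarFun (k := k) j) := by
  refine continuous_pi fun i => ?_
  refine Fin.cases ?_ (fun m => ?_) i
  · simp only [stellarFun_zero]; fun_prop
  · simp only [stellarFun_succ]; fun_prop

/-- **The stellar point**: the stellar map on the region `{sⱼ minimal}` of the standard simplex,
valued in the standard simplex. [folklore] -/
def stellarPt (j : Fin (k + 1)) (s : stdSimplex ℝ (Fin (k + 1))) (h : ∀ l, s j ≤ s l) :
    stdSimplex ℝ (Fin (k + 1)) :=
  ⟨stellarFun j s, by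
    refine ⟨fun i => ?_, sum_stellarFun j (stdSimplex.sum_eq_one s)⟩
    refine Fin.cases ?_ (fun m => ?_) i
    · rw [stellarFun_zero]; exact mul_nonneg (by positivity) (stdSimplex.zero_le s j)
    · rw [stellarFun_succ]; linarith [h (j.succAbove m)]⟩

/-- Coordinates of the stellar point. [folklore] -/
@[simp] theorem stellarPt_apply (j : Fin (k + 1)) (s : stdSimplex ℝ (Fin (k + 1))) (h : ∀ l, s j ≤ s l)
    (i : Fin (k + 1)) : stellarPt j s h i = stellarFun j s i := rfl

/-- **The stellar map sends the relative boundary of the region to the boundary**: if two minimal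
coordinates coincide or some coordinate vanishes, the stellar point has a vanishing coordinate.
[folklore] -/
theorem exists_stellarPt_eq_zero (j : Fin (k + 1)) (s : stdSimplex ℝ (Fin (k + 1))) (h : ∀ l, s j ≤ s l)
    (hs : (∃ l, l ≠ j ∧ s j = s l) ∨ ∃ i, s i = 0) : ∃ i, stellarPt j s h i = 0 := by
  rcases hs with ⟨l, hlj, hl⟩ | ⟨i, hi⟩
  · obtain ⟨m, rfl⟩ := Fin.exists_succAbove_eq hlj
    exact ⟨m.succ, by simp [hl]⟩
  · -- the minimum is `0`
    have hj : s j = 0 := le_antisymm (hi ▸ h i) (stdSimplex.zero_le s j)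
    exact ⟨0, by simp [hj]⟩

/-! ### Interior points of the stellar cells -/

/-- The parameter pushing the centre away from the vertex `j`: `ε j = (j + 1) / (4 (k + 1)²)`.
[folklore] -/
def stellarEps (k : ℕ) (j : Fin (k + 1)) : ℝ := ((j : ℝ) + 1) / (4 * ((k : ℝ) + 1) ^ 2)

/-- `0 < ε j`. [folklore] -/
theorem stellarEps_pos (j : Fin (k + 1)) : 0 < stellarEps k j := by unfold stellarEps; positivity

/-- `(k + 1) ε j < 1` (indeed `≤ 1/4`). [folklore] -/
theorem stellarEps_lt (j : Fin (k + 1)) : ((k : ℝ) + 1) * stellarEps k j < 1 := by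
  unfold stellarEps
  have hj : (j : ℝ) + 1 ≤ (k : ℝ) + 1 := by
    have := j.2; exact_mod_cast (by omega : (j : ℕ) + 1 ≤ k + 1)
  have hk1 : (0 : ℝ) < (k : ℝ) + 1 := by positivity
  rw [mul_div_assoc', div_lt_one (by positivity)]
  nlinarith

/-- **The stellar centre** of the cell `j`: in barycentric coordinates
`(1 + ε)/(k+1) - ε [l = j]`, i.e. the centre pushed away from the vertex `j`. [folklore] -/
def stellarCenter (j : Fin (k + 1)) : Fin k → ℝ := fun m =>
  (1 + stellarEps k j) / ((k : ℝ) + 1) - if m.succ = j then stellarEps k j else 0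

/-- Barycentric coordinates of the stellar centre. [folklore] -/
theorem baryCoords_stellarCenter (j : Fin (k + 1)) (l : Fin (k + 1)) :
    baryCoords (stellarCenter (k := k) j) l =
      (1 + stellarEps k j) / ((k : ℝ) + 1) - if l = j then stellarEps k j else 0 := by
  refine Fin.cases ?_ (fun m => ?_) l
  · rw [baryCoords_zero]
    simp only [stellarCenter, Finset.sum_sub_distrib, Finset.sum_const, Finset.card_univ,
      Fintype.card_fin, nsmul_eq_mul]
    have hk1 : ((k : ℝ) + 1) ≠ 0 := by positivity
    by_cases hj : j = 0
    · subst hj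
      simp only [Fin.succ_ne_zero, if_false, Finset.sum_const_zero, sub_zero, if_true]
      field_simp; ring
    · obtain ⟨j', rfl⟩ := Fin.exists_succ_eq.2 hj
      rw [if_neg (Fin.succ_ne_zero j').symm]
      have : ∑ m : Fin k, (if (m.succ : Fin (k + 1)) = j'.succ then stellarEps k j'.succ else 0) =
          stellarEps k j'.succ := by
        simp only [Fin.succ_inj]; rw [Finset.sum_ite_eq']; simp
      rw [this]; field_simp; ring
  · rw [baryCoords_succ]; rfl

/-- The stellar centre is an interior point of its cell. [folklore] -/
theorem stellarCenter_mem_interior (j : Fin (k + 1)) : stellarCenter j ∈ interior (stellarCell (k := k) j) := by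
  have hε := stellarEps_pos (k := k) j
  have hε' := stellarEps_lt (k := k) j
  have hk1 : (0 : ℝ) < (k : ℝ) + 1 := by positivity
  have hbase : 0 < (1 + stellarEps k j) / ((k : ℝ) + 1) - stellarEps k j := by
    rw [sub_pos, lt_div_iff₀ hk1]; nlinarith
  refine mem_interior_stellarCell (fun l hl => ?_) (fun i => ?_)
  · rw [baryCoords_stellarCenter, baryCoords_stellarCenter, if_pos rfl, if_neg hl]; linarith
  · rw [baryCoords_stellarCenter]
    split_ifs
    · exact hbase
    · rw [sub_zero]; positivity

/-- The stellar centre lies in the corner simplex. [folklore] -/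
theorem stellarCenter_mem (j : Fin (k + 1)) : stellarCenter j ∈ cornerSimplex k :=
  (interior_subset (stellarCenter_mem_interior j)).1

end Literature.AlgebraicTopology.Homotopy

end
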